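import Summits.QuantumFields.YangMills.Theorems.ColdStartUniversalityShenZhuZhuWeightedW2GeometricErgodicitySU2
import Summits.QuantumFields.YangMills.Theorems.ColdStartUniversalityUniformColdStartMixingFixedCutoffMixingTimeWindow
import HarnessLib

/-!
# Route `ColdStartUniversality` (fixed-cut-off package): the VOLUME-FREE weighted `W₂` cold-start bound AT THE ROUTE'S CUT-OFFS, window `γε_K > 6`:
# `W₂^(ρ_(∞,a)∘torusLift)(δ_Q P^(K)_t, μ_K)² ≤ exp(−2(1 − (4+6(a+1)/√a)|β'_K|)t)·2π²·Σ_(ẽ∈E⁺(ℤ³)) a^(−|ẽ|)` — NO `#E_K` factor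

Planner-facing helper file (seat `ym-line-csu-p1`, g43; `--supports stmt-QuantumFields-24809`).  g42's G66/G68 gave the cold-start `W₂^(ρ_L)` bound with the
volume prefactor `2π²·#E_K`; with Shen–Zhu–Zhu's weighted distance `ρ_(∞,a)` (g43: `wilson_weightedW2_convergence_dirac_volumeFree`) the prefactor is the
volume-independent constant `2π²·Σ_(ẽ) a^(−|ẽ|)`, `a > 1` free, at the price of the rate `1 − (4+6(√a²+1)/√a)|β'_K|` (`→ 1 − 16|β'_K|` as `a → 1`).  At the route's
`K`-th cut-off (`L_K = (F.P K).sitesPerDir 0`, `β'_K = (γε_K)⁻¹/2`, window `6 < γε_K` so `|β'_K| < 1/12`):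
* ★★ `weightedW2_coldStart_volumeFree_fixedCutoff_window` — for every `a > 1`, every realising kernel family of the `K`-th dynamics, every start `Q`, `t > 0`:
  `szzWassersteinSq (ρ_(∞,a)∘torusLift)² (κ_t Q) μ_K ≤ ofReal(exp(−2(1 − (4+6(√a²+1)/√a)·|β'_K|)·t)·2π²·Σ'_(ẽ) a^(−|ẽ|))`.
THEOREMS ONLY, no definition, no sorry.  PLANNER-FACING, HONEST: the PREFACTOR is uniform in `K` (volume-free) but the RATE is not — `|β'_K| = (γε_K)⁻¹/2 → ∞`
as `ε_K → 0` at fixed `γ` and the bound is informative only while `(4+6(√a²+1)/√a)|β'_K| < 1`; so this is NOT `UniformColdStartMixing` (stmt-24809, ASIDE, NOT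
restated or weakened): of the two obstructions to `K`-uniformity in the `W₂` statements (volume prefactor, rate window) it removes exactly the first.  No crux,
rung or summit statement is proved; the Yang–Mills mass gap is NOT proved.
-/

set_option autoImplicit false

noncomputable section

namespace Summit.QuantumFields.YangMills.Theorems.ColdStartUniversality

open MeasureTheory ProbabilityTheory Matrix Complex Finset Filter Topology Set
open scoped BigOperators Real NNReal ENNReal
open Literature.Probability.Process Literature.MathematicalPhysics.QuantumFieldTheory
open Literature.MathematicalPhysics.QuantumFieldTheory.Balaban1983to89
open Literature.MathematicalPhysics.QuantumLattice (fundamentalRep fundamentalLatticeRep continuous_fundamentalRep fundamentalRep_apply fundamentalLatticeRep_N)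

/-- ★★ **Volume-free weighted `W₂` cold-start bound at the route's cut-offs, window `γε_K > 6`.**  For every cut-off `K` with `6 < γε_K`, every `a > 1`, every
realising kernel family `κ` of the `K`-th SZZ dynamics (`β'_K = (γε_K)⁻¹/2` on `(ℤ/L_K)³`), every deterministic start `Q` and every lattice time `t > 0`:
`szzWassersteinSq (ρ_(∞,a)∘torusLift)² (κ_t Q) μ_K ≤ ofReal(exp(−2(1 − (4+6(√a²+1)/√a)|β'_K|)·t)·2π²·Σ'_(ẽ∈E⁺(ℤ³)) a^(−|ẽ|))` — the right-hand side has NO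
volume factor.  NOT `K`-uniform (the rate window closes as `ε_K → 0`); the Yang–Mills mass gap is NOT proved. [cite: ShenZhuZhuCMP2023, Lemma 5.1] -/
theorem weightedW2_coldStart_volumeFree_fixedCutoff_window (F : T3ContinuumYM3Torus.T3Family) (γ : ℝ) (K : ℕ) (hK : 6 < γ * (F.P K).eps)
    {a : ℝ} (ha : 1 < a)
    (κ : ℝ≥0 → Kernel (GaugeConfig 3 ((F.P K).sitesPerDir 0) (Matrix.specialUnitaryGroup (Fin 2) ℂ)) (GaugeConfig 3 ((F.P K).sitesPerDir 0) (Matrix.specialUnitaryGroup (Fin 2) ℂ))) [∀ t, IsMarkovKernel (κ t)]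
    (hreal : ∀ (t : ℝ≥0) (x : GaugeConfig 3 ((F.P K).sitesPerDir 0) (Matrix.specialUnitaryGroup (Fin 2) ℂ))
        (Ω : Type) [MeasurableSpace Ω] (P : Measure Ω) [IsProbabilityMeasure P]
        (W : ℝ≥0 → Ω → (Edge 3 ((F.P K).sitesPerDir 0) × NoiseIdx 2 → ℝ)) (hW : IsFlatBrownian W P)
        (U : ℝ≥0 → Ω → GaugeConfig 3 ((F.P K).sitesPerDir 0) (Matrix.specialUnitaryGroup (Fin 2) ℂ)),
        (∀ ω, U 0 ω = x) →
        (latticeLangevinDynamics (fundamentalLatticeRep 2) ((γ * (F.P K).eps)⁻¹ / 2)).IsSolution (fundamentalRep (Fin 2))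
          hW.natFiltration P W U →
        κ t x = P.map (U t))
    (Q : GaugeConfig 3 ((F.P K).sitesPerDir 0) (Matrix.specialUnitaryGroup (Fin 2) ℂ)) {t : ℝ≥0} (ht : 0 < (t : ℝ)) :
    szzWassersteinSq (fun U U' : GaugeConfig 3 ((F.P K).sitesPerDir 0) (Matrix.specialUnitaryGroup (Fin 2) ℂ) => weightedRiemannDistSq (fundamentalLatticeRep 2) a (Literature.MathematicalPhysics.QuantumLattice.torusLift ((F.P K).sitesPerDir 0) U) (Literature.MathematicalPhysics.QuantumLattice.torusLift ((F.P K).sitesPerDir 0) U')) (κ t Q) (wilsonMeasure (d := 3) (L := ((F.P K).sitesPerDir 0)) (fundamentalRep (Fin 2)) ((γ * (F.P K).eps)⁻¹ / 2)) ≤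
      ENNReal.ofReal (Real.exp (-(2 * (1 - (4 + 6 * ((Real.sqrt a ^ 2 + 1) / Real.sqrt a)) * |((γ * (F.P K).eps)⁻¹ / 2)|) * (t : ℝ))) *
        (2 * Real.pi ^ 2 * ∑' et : Literature.MathematicalPhysics.QuantumLattice.ZdEdge 3, (a ^ edgeLevel et)⁻¹)) := by
  haveI : NeZero ((F.P K).sitesPerDir 0) := inferInstance
  obtain ⟨hβ, -⟩ := window_coupling_bounds F γ K hK
  exact wilson_weightedW2_convergence_dirac_volumeFree ((F.P K).sitesPerDir 0) Q ((γ * (F.P K).eps)⁻¹ / 2) hβ ha κ hreal ht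

end Summit.QuantumFields.YangMills.Theorems.ColdStartUniversality
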